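import Summits.Langlands.Langlands.Theorems.SqrtFiveQuarticCoversAbsReduction
import Summits.Langlands.Langlands.Theorems.SqrtFiveQuarticCoversZDSToolkit

/-!
# Route `Langlands/SqrtFiveQuarticCovers` — reduction lemma (I), relative form: over a quartic
# number field `K ∋ √5`, an integer polynomial whose reduction modulo a prime `ℓ` split in `ℚ(√5)`
# has no irreducible factor of degree `≤ 2` has no root (cell `pub/lg-quartmod`, F-L1, sheet 4.5;
# reusable, closes nothing by itself)

Sequel of `SqrtFiveQuarticCoversAbsReduction` ((I₀), the engine `exists_irreducible_dvd_map_of_root`).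
For the m×m eliminant factor `F₁₆` of the E10-ZDS census no prime leaves `F₁₆ mod ℓ` free of
factors of degree `≤ 4` (Galois obstruction, ref-2 / eng-7 g4 / ref-1 g2, three toolchains), so the
absolute lemma (I₀) cannot bite; but a root `x ∈ K` of `F₁₆` has degree `≤ 2` over `k = ℚ(√5)`, so
at a prime `ℓ` SPLIT in `k` its reduction has degree `≤ 2` over `𝔽_ℓ` — and `F₁₆ mod 19` has no
factor of degree `≤ 2` (certificate: cell seat in-zanch).  This file proves that relative bound in
elementary dress:

* (reused from `SqrtFiveQuarticCoversZDSToolkit`, eng-7 g4: `exists_involution_fixing_sqrt_five` —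
  the involution `σ` of `K/ℚ(r)` with fixed set `ℚ + ℚ·r`; `eq_zero_of_rat_add_rat_mul_sqrt_five` —
  `1, r` are `ℚ`-linearly independent);
* `exists_int_eq_two_mul_of_isIntegral_rat_add_rat_mul` — half-integrality: `a + b·r` an algebraic
  integer (`a b : ℚ`) ⇒ `2a ∈ ℤ` (its minimal polynomial over `ℚ`, `X − a` or `X² − 2aX + (a² − 5b²)`,
  has integer coefficients); applied to `r·(a + b r)` it gives `10b ∈ ℤ`;
* `aeval_ne_zero_of_irreducible_factors_natDegree_gt_two` — **(I)**: `[K:ℚ] = 4`, `r² = 5`,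
  `ℓ ∉ {2, 5}` prime, `ℓ ∣ s² − 5` for an integer `s`, `ℓ ∤ lc(P)`, every irreducible factor of
  `P mod ℓ` of degree `> 2` ⇒ `∀ x : K, P(x) ≠ 0`.  Proof: `y = lc(P)·x`; `T = y + σy`, `N = y·σy`
  are algebraic integers in `ℚ + ℚr`, so `10T = 5t₁ + t₂ r`, `10N = 5n₁ + n₂ r` (`tᵢ, nᵢ ∈ ℤ`) and
  `10y² − 10T·y + 10N = 0`; modulo a prime `𝔓 ∣ ℓ` of `𝓞 K`, `r ≡ ±s`, so `H = 10X² − (5t₁ ± t₂s)X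
  + (5n₁ ± n₂s)` (degree `2` as `ℓ ∤ 10`) kills `ȳ`, and the engine yields a factor of degree `≤ 2`.
  This is the residue-degree bound `f(𝔓 | ℓ) ≤ [K : k] = 2` at split primes, without relative
  Dedekind theory.  Certificate primes: `ℓ = 19, s = 9` (`F₁₆`); `ℓ = 29, s = 11` / `ℓ = 59, s = 8` (`Q₄′`).

HONEST STATUS: elementary algebraic number theory; serves certificates about ONE explicit
0-dimensional scheme of the route; proves nothing about modularity.  Cell record: lead g2 STATUS
2026-08-28T22:29:37Z (ROSTER seat 1b), 22:39:53Z (a); ref-2 ELIMINANTS-E10ZDS.md §(I); ref-1 g2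
DDF pre-replay 22:40:40Z.  [folklore; cf. Marcus, *Number Fields*, Ch. 3–4]
-/

set_option linter.dupNamespace false -- project-wide option (lakefile weak.linter.dupNamespace); `Summit.Langlands.Langlands` is the mandated namespace

namespace Summit.Langlands.Langlands.Theorems.SqrtFiveQuarticCovers

open Polynomial NumberField
open scoped IntermediateField

/-! ## 1. Half-integrality on `ℚ(√5) ⊂ K` -/

/-- **Half-integrality on `ℚ(√5)`.**  If `a + b·r` (`a b : ℚ`, `r² = 5`) is an algebraic integer of
the number field `K`, then `2a ∈ ℤ` (its minimal polynomial over `ℚ`, which is `X − a` or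
`X² − 2aX + (a² − 5b²)`, has integer coefficients).  Applied to `r·(a + b r) = 5b + a r` it also
gives `10b ∈ ℤ`. [folklore] -/
theorem exists_int_eq_two_mul_of_isIntegral_rat_add_rat_mul {K : Type} [Field K] [NumberField K]
    {r : K} (hr : r ^ 2 = 5) {a b : ℚ} (hint : IsIntegral ℤ ((a : K) + (b : K) * r)) :
    ∃ m : ℤ, (m : ℚ) = 2 * a := by
  set w : K := (a : K) + (b : K) * r with hw
  -- `w` is a root of the rational quadratic `q = X² − 2aX + (a² − 5b²)`
  set q : ℚ[X] := X ^ 2 + C (-(2 * a)) * X + C (a ^ 2 - 5 * b ^ 2) with hqdef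
  have hqm : q.Monic := by
    rw [hqdef]
    monicity!
  have hqdeg : q.natDegree = 2 := by
    rw [hqdef]
    compute_degree!
  have hqw : aeval w q = 0 := by
    rw [hqdef]
    simp only [map_add, map_mul, map_pow, aeval_X, aeval_C, eq_ratCast]
    push_cast
    rw [hw]
    linear_combination ((b : K) ^ 2) * hr
  -- the minimal polynomial of `w` over `ℚ` has integer coefficients and divides `q`
  set μ : ℚ[X] := minpoly ℚ w with hμdef
  have hμZ : μ = (minpoly ℤ w).map (algebraMap ℤ ℚ) :=
    minpoly.isIntegrallyClosed_eq_field_fractions' ℚ hint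
  have hμcoeff : ∀ i, μ.coeff i = ((minpoly ℤ w).coeff i : ℚ) := fun i => by
    rw [hμZ, coeff_map, algebraMap_int_eq, Int.coe_castRingHom]
  have hwint : IsIntegral ℚ w := Algebra.IsIntegral.isIntegral w
  have hμm : μ.Monic := minpoly.monic hwint
  have hμdvd : μ ∣ q := minpoly.dvd ℚ w hqw
  have hμle : μ.natDegree ≤ 2 := hqdeg ▸ natDegree_le_of_dvd hμdvd hqm.ne_zero
  have hμpos : 0 < μ.natDegree := minpoly.natDegree_pos hwint
  by_cases hμ2 : μ.natDegree = 2
  · -- `μ = q`, so `−2a = μ.coeff 1 ∈ ℤ`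
    have hμq : q = μ := eq_of_monic_of_dvd_of_natDegree_le hμm hqm hμdvd (by rw [hqdeg, hμ2])
    have h1 : q.coeff 1 = -(2 * a) := by
      rw [hqdef]
      simp only [coeff_add, coeff_X_pow, coeff_C_mul, coeff_X, coeff_C]
      norm_num
    refine ⟨-(minpoly ℤ w).coeff 1, ?_⟩
    rw [Int.cast_neg, ← hμcoeff, ← hμq, h1, neg_neg]
  · -- `μ` linear: `w ∈ ℚ`, forcing `b = 0` and `a ∈ ℤ`
    have hμ1 : μ.natDegree = 1 := by omega
    have hlc : μ.coeff 1 = 1 := by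
      have h := hμm.coeff_natDegree
      rwa [hμ1] at h
    have hμeq : μ = X + C (μ.coeff 0) :=
      calc μ = C (μ.coeff 1) * X + C (μ.coeff 0) := eq_X_add_C_of_natDegree_le_one hμ1.le
        _ = X + C (μ.coeff 0) := by rw [hlc, C_1, one_mul]
    have hw0 : w = -(((minpoly ℤ w).coeff 0 : ℚ) : K) := by
      have h := minpoly.aeval ℚ w
      rw [← hμdef, hμeq, map_add, aeval_X, aeval_C, eq_ratCast, hμcoeff 0] at h
      linear_combination h
    set m : ℤ := (minpoly ℤ w).coeff 0 with hm
    have hwm : (a : K) + (b : K) * r = -(m : K) := by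
      rw [← hw, hw0]
      push_cast
      ring
    by_cases hb : b = 0
    · refine ⟨-(2 * m), ?_⟩
      rw [hb, Rat.cast_zero, zero_mul, add_zero] at hwm
      have ha : (a : K) = (((-m : ℤ) : ℚ) : K) := by
        rw [hwm]
        push_cast
        ring
      have ha' : a = ((-m : ℤ) : ℚ) := by exact_mod_cast ha
      rw [ha']
      push_cast
      ring
    · exact absurd (eq_zero_of_rat_add_rat_mul_sqrt_five hr (a := a + m) (b := b)
        (by push_cast; linear_combination hwm)).2 hb

/-! ## 2. (I) The relative reduction lemma for a quartic `K ∋ √5` -/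

/-- `10 ≢ 0 (mod ℓ)` for a prime `ℓ ∉ {2, 5}`. [folklore] -/
theorem intCast_ten_ne_zero_zmod {ℓ : ℕ} [hℓ : Fact ℓ.Prime] (h2 : ℓ ≠ 2) (h5 : ℓ ≠ 5) :
    ((10 : ℤ) : ZMod ℓ) ≠ 0 := by
  rw [Ne, ZMod.intCast_zmod_eq_zero_iff_dvd]
  intro h
  have h' : ℓ ∣ 2 * 5 := by exact_mod_cast h
  rcases (Nat.Prime.dvd_mul hℓ.out).1 h' with h | h
  · exact h2 ((Nat.prime_dvd_prime_iff_eq hℓ.out Nat.prime_two).1 h)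
  · exact h5 ((Nat.prime_dvd_prime_iff_eq hℓ.out Nat.prime_five).1 h)

/-- **(I) Relative reduction lemma.**  Let `K` be a quartic number field containing `r` with
`r² = 5`, `ℓ ∉ {2, 5}` a prime modulo which `5` is a square (`ℓ ∣ s² − 5` for some integer `s`,
i.e. `ℓ` splits in `k = ℚ(√5)`), and `P ∈ ℤ[X]` with `ℓ ∤ lc(P)`.  If every irreducible factor of
`P mod ℓ` in `𝔽_ℓ[X]` has degree `> 2`, then `P` has no root in `K`.  Proof: `y = lc(P)·x ∈ 𝓞 K`;
with `σ` the involution of `K/k`, `T = y + σy` and `N = y·σy` are algebraic integers in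
`k = ℚ + ℚr`, hence `2T, 2N ∈ ℤ + ℤ·(r/5)·…` — precisely `10T = 5t₁ + t₂ r`, `10N = 5n₁ + n₂ r` with
`tᵢ, nᵢ ∈ ℤ` (half-integrality) — and `10y² − 10T·y + 10N = 0`; modulo a prime `𝔓 ∣ ℓ` of `𝓞 K`
one has `r ≡ ±s`, so `ȳ` is a root of the quadratic `10X² − (5t₁ ± t₂ s)X + (5n₁ ± n₂ s) ∈ 𝔽_ℓ[X]`
(nonzero as `ℓ ∤ 10`); the engine then produces an irreducible factor of `P mod ℓ` of degree `≤ 2`.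
This is the residue-degree bound `f(𝔓 | ℓ) ≤ [K : k] = 2` at primes split in `k`, in elementary
dress (no relative Dedekind theory).  Plug-in form for the cell's `𝔽_ℓ[X]`-gcd certificates
(`F₁₆ mod 19`, `Q₄′ mod 29 / 59`: «no factor of degree `≤ 2`»; ref-2 ELIMINANTS-E10ZDS.md §(I),
ref-1 g2 DDF pre-replay). [folklore] -/
theorem aeval_ne_zero_of_irreducible_factors_natDegree_gt_two {K : Type} [Field K]
    [NumberField K] (hd : Module.finrank ℚ K = 4) {r : K} (hr : r ^ 2 = 5) {ℓ : ℕ} [Fact ℓ.Prime]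
    (hℓ2 : ℓ ≠ 2) (hℓ5 : ℓ ≠ 5) {s : ℤ} (hs : (ℓ : ℤ) ∣ s ^ 2 - 5) {P : ℤ[X]}
    (hc : ((P.leadingCoeff : ℤ) : ZMod ℓ) ≠ 0)
    (hP : ∀ g : (ZMod ℓ)[X], Irreducible g → g ∣ P.map (Int.castRingHom (ZMod ℓ)) →
      2 < g.natDegree)
    (x : K) : aeval x P ≠ 0 := by
  intro hx
  -- `y = lc(P)·x` is an algebraic integer
  set yK : K := (P.leadingCoeff : K) * x with hyK
  have hyint : IsIntegral ℤ yK := by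
    have h := isIntegral_leadingCoeff_smul P x hx
    rwa [Algebra.smul_def, algebraMap_int_eq, Int.coe_castRingHom] at h
  set y : 𝓞 K := ⟨yK, hyint⟩ with hydef
  have hy : (y : K) = (P.leadingCoeff : K) * x := rfl
  have hrint : IsIntegral ℤ r :=
    ⟨X ^ 2 - C 5, by monicity!, by simp [hr]⟩
  set r₀ : 𝓞 K := ⟨r, hrint⟩ with hr₀def
  -- the involution `σ` of `K / ℚ(r)`; trace and norm of `y`
  obtain ⟨σ, -, -, hσσ, hfix⟩ := exists_involution_fixing_sqrt_five hd hr
  have hy'int : IsIntegral ℤ (σ yK) := hyint.map σ.toIntAlgHom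
  set T : K := yK + σ yK with hT
  set N : K := yK * σ yK with hN
  have hTint : IsIntegral ℤ T := hyint.add hy'int
  have hNint : IsIntegral ℤ N := hyint.mul hy'int
  have hσT : σ T = T := by rw [hT, map_add, hσσ, add_comm]
  have hσN : σ N = N := by rw [hN, map_mul, hσσ, mul_comm]
  obtain ⟨a, b, hab⟩ := hfix T hσT
  obtain ⟨a', b', hab'⟩ := hfix N hσN
  -- half-integrality: `2a, 10b, 2a', 10b' ∈ ℤ`
  have hrT : r * T = ((5 * b : ℚ) : K) + ((a : ℚ) : K) * r := by
    rw [hab]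
    push_cast
    linear_combination (b : K) * hr
  have hrN : r * N = ((5 * b' : ℚ) : K) + ((a' : ℚ) : K) * r := by
    rw [hab']
    push_cast
    linear_combination (b' : K) * hr
  obtain ⟨t₁, ht₁⟩ := exists_int_eq_two_mul_of_isIntegral_rat_add_rat_mul hr (hab ▸ hTint)
  obtain ⟨t₂, ht₂⟩ :=
    exists_int_eq_two_mul_of_isIntegral_rat_add_rat_mul hr (hrT ▸ hrint.mul hTint)
  obtain ⟨n₁, hn₁⟩ := exists_int_eq_two_mul_of_isIntegral_rat_add_rat_mul hr (hab' ▸ hNint)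
  obtain ⟨n₂, hn₂⟩ :=
    exists_int_eq_two_mul_of_isIntegral_rat_add_rat_mul hr (hrN ▸ hrint.mul hNint)
  have ht₁K : (t₁ : K) = 2 * (a : K) := by
    have h : ((t₁ : ℚ) : K) = ((2 * a : ℚ) : K) := by rw [ht₁]
    push_cast at h
    exact h
  have ht₂K : (t₂ : K) = 10 * (b : K) := by
    have h : ((t₂ : ℚ) : K) = ((2 * (5 * b) : ℚ) : K) := by rw [ht₂]
    push_cast at h
    linear_combination h
  have hn₁K : (n₁ : K) = 2 * (a' : K) := by
    have h : ((n₁ : ℚ) : K) = ((2 * a' : ℚ) : K) := by rw [hn₁]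
    push_cast at h
    exact h
  have hn₂K : (n₂ : K) = 10 * (b' : K) := by
    have h : ((n₂ : ℚ) : K) = ((2 * (5 * b') : ℚ) : K) := by rw [hn₂]
    push_cast at h
    linear_combination h
  -- the integral quadratic relation `10y² − (5t₁ + t₂ r)y + (5n₁ + n₂ r) = 0`
  have hrel : 10 * yK ^ 2 - (5 * (t₁ : K) + (t₂ : K) * r) * yK + (5 * (n₁ : K) + (n₂ : K) * r) = 0 := by
    have h0 : yK ^ 2 - T * yK + N = 0 := by
      rw [hT, hN]
      ring
    rw [hab, hab'] at h0
    linear_combination 10 * h0 - 5 * yK * ht₁K - r * yK * ht₂K + 5 * hn₁K + r * hn₂K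
  have hrelO : (10 * y ^ 2 - (5 * (t₁ : 𝓞 K) + (t₂ : 𝓞 K) * r₀) * y
      + (5 * (n₁ : 𝓞 K) + (n₂ : 𝓞 K) * r₀) : 𝓞 K) = 0 := by
    apply FaithfulSMul.algebraMap_injective (𝓞 K) K
    simp only [map_sub, map_add, map_mul, map_pow, map_ofNat, map_intCast, map_zero]
    rw [← RingOfIntegers.coe_eq_algebraMap, ← RingOfIntegers.coe_eq_algebraMap]
    exact hrel
  -- a prime `𝔓 ∣ ℓ` of `𝓞 K`; `r ≡ s'` for `s' = ±s`
  obtain ⟨𝔓, h𝔓, hℓ𝔓⟩ :=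
    Literature.NumberTheory.EllipticCurves.exists_isMaximal_natCast_mem (K := K) (Fact.out : ℓ.Prime)
  have hrs : (r₀ - s) * (r₀ + s) ∈ 𝔓 := by
    obtain ⟨k, hk⟩ := hs
    have hr₀ : r₀ ^ 2 = 5 := by
      apply FaithfulSMul.algebraMap_injective (𝓞 K) K
      rw [map_pow, map_ofNat, ← RingOfIntegers.coe_eq_algebraMap]
      exact hr
    have hk' : ((s : 𝓞 K)) ^ 2 - 5 = (ℓ : 𝓞 K) * (k : 𝓞 K) := by exact_mod_cast congrArg (Int.cast : ℤ → 𝓞 K) hk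
    have h : (r₀ - s) * (r₀ + s) = -((ℓ : 𝓞 K) * k) := by linear_combination hr₀ - hk'
    rw [h]
    exact 𝔓.neg_mem (𝔓.mul_mem_right _ hℓ𝔓)
  obtain ⟨s', hs'⟩ : ∃ s' : ℤ, (r₀ : 𝓞 K) - (s' : 𝓞 K) ∈ 𝔓 := by
    rcases h𝔓.isPrime.mem_or_mem hrs with h | h
    · exact ⟨s, h⟩
    · refine ⟨-s, ?_⟩
      rw [Int.cast_neg, sub_neg_eq_add]
      exact h
  -- the quadratic `H = 10X² − (5t₁ + t₂ s')X + (5n₁ + n₂ s')` kills `y` modulo `𝔓`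
  set H : ℤ[X] := C 10 * X ^ 2 + C (-(5 * t₁ + t₂ * s')) * X + C (5 * n₁ + n₂ * s') with hH
  have hHy : aeval y H ∈ 𝔓 := by
    have h : aeval y H = ((t₂ : 𝓞 K) * y - n₂) * (r₀ - s') := by
      rw [hH]
      simp only [map_add, map_mul, map_neg, map_pow, aeval_X, eq_intCast, map_intCast, map_ofNat]
      linear_combination hrelO
    rw [h]
    exact 𝔓.mul_mem_left _ hs'
  have hHdeg : H.natDegree = 2 := by
    rw [hH]
    compute_degree!
  have hHlc : H.leadingCoeff = 10 := by
    rw [hH]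
    exact leadingCoeff_quadratic (by norm_num)
  have hdegmap : (H.map (Int.castRingHom (ZMod ℓ))).natDegree = 2 := by
    rw [natDegree_map_of_leadingCoeff_ne_zero _ (by
      rw [hHlc, eq_intCast]
      exact intCast_ten_ne_zero_zmod hℓ2 hℓ5), hHdeg]
  have hH0 : H.map (Int.castRingHom (ZMod ℓ)) ≠ 0 := by
    intro h
    rw [h, natDegree_zero] at hdegmap
    exact absurd hdegmap (by norm_num)
  haveI := h𝔓
  obtain ⟨g, hgirr, hgdvd, hgdeg⟩ := exists_irreducible_dvd_map_of_root hℓ𝔓 hc hx hy hH0 hHy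
  exact absurd (hP g hgirr hgdvd) (not_lt.2 (hgdeg.trans hdegmap.le))

end Summit.Langlands.Langlands.Theorems.SqrtFiveQuarticCovers
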